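import Summits.CriticalPhenomena.SAWScalingLimit.Theorems.SAWLeftRightFKGLeftRightFKGLadderStructureAux
import Summits.CriticalPhenomena.SAWScalingLimit.Theorems.SAWLeftRightFKGLeftRightFKGDefs
import HarnessLib

/-!
# Crux `LeftRightFKG` (stmt-CriticalPhenomena-11232), line `corner-localisation` (v9):
combinatorics of self-avoiding walks in a 2-row ladder (`stub_ladderStructure`, tool T4a)

If `Ω_1 = discreteDomainGraph Ω 1` is the lattice graph induced on the ladder `{0..L} × {0, 1}`
(adjacency = lattice adjacency inside the open box `(-1, L+1) × (-1, 2)`), then for the chords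
`γ : (0, 0) ⇝ (L, 0)` (self-avoiding walks of `Ω_1`): (i) every chord stays in the ladder;
(ii) each crossing count `wcross i 0 γ` (`i < L`: net number of eastward darts across the line
`x = i + ½` at height `≥ 1`) is `0` or `1` — it is the ROW of the unique, eastward, step of `γ` from
column `i` to column `i + 1`; (iii) `|γ| = L + #{i ≤ L : [1 ≤ wcross i 0 γ] ≠ [1 ≤ wcross (i-1) 0 γ]}`
(one horizontal step per column gap plus one rung per change of row; the counts at the phantom
faces `-1` and `L` vanish); (iv) a chord is determined by its crossing counts; (v) every `0/1`
pattern of crossing counts occurs.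

(i)–(iv) are the case `i = 0` of the structure theorem for tails of chords
`stub_ladderStructureAux` (module `…LadderStructureAux`, induction on the column via the column
step: first step East, or rung then East); (v) is the explicit chord built by downward induction on
the column (`ladder_exists`: from `(i, r)` step East if the prescribed row of gap `i` is `r`, else
take the rung first). Everything is elementary; no named facts are used. [folklore]
-/

open Literature.Probability.LatticeModels Literature.Probability.RandomPlanarGeometry
open Summit.CriticalPhenomena.SAWScalingLimit.Theorems.LeftRightFKG.Negative (bx pathCross wcross)
open Summit.CriticalPhenomena.SAWScalingLimit.Theorems.LeftRightFKG.CornerLoc (lr IsUp μx dom IsInst)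
open Literature.Probability.Percolation.Contour (site_ext)

namespace Summit.CriticalPhenomena.SAWScalingLimit.Theorems.LeftRightFKG.Families

section Ladder

variable {G : SimpleGraph (Site 2)} {L : ℕ}

/-- A walk none of whose vertices lies in column `m`, or none in column `m + 1`, does not cross the
line `x = m + ½`. [folklore] -/
private theorem wcross_eq_zero_of_col (m k : ℤ) {u v : Site 2} (p : G.Walk u v)
    (h : (∀ x ∈ p.support, x 0 ≠ m) ∨ (∀ x ∈ p.support, x 0 ≠ m + 1)) : wcross m k p = 0 := by
  rw [Negative.wcross_eq_darts]
  refine List.sum_eq_zero fun a ha => ?_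
  obtain ⟨d, hd, rfl⟩ := List.mem_map.1 ha
  have h1 := p.dart_fst_mem_support_of_mem_darts hd
  have h2 := p.dart_snd_mem_support_of_mem_darts hd
  unfold Negative.edgeCross
  rcases h with h | h
  · have := h _ h1; have := h _ h2; split_ifs <;> omega
  · have := h _ h1; have := h _ h2; split_ifs <;> omega

variable (hG : ∀ u v : Site 2, G.Adj u v ↔
  (zdGraph 2).Adj u v ∧ u ∈ Negative.Rect.box (-1) (L + 1) (-1) 2 ∧ v ∈ Negative.Rect.box (-1) (L + 1) (-1) 2)
include hG

/-- Lattice-adjacent ladder sites are adjacent in the ladder graph. [folklore] -/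
private theorem adj_of_ladder {i j i' j' : ℤ} (h : (zdGraph 2).Adj (bx i j) (bx i' j'))
    (hu : (0 ≤ i ∧ i ≤ L) ∧ (0 ≤ j ∧ j ≤ 1)) (hv : (0 ≤ i' ∧ i' ≤ L) ∧ (0 ≤ j' ∧ j' ≤ 1)) :
    G.Adj (bx i j) (bx i' j') :=
  (hG _ _).2 ⟨h, by simp only [Negative.Rect.box, Set.mem_setOf_eq, Negative.bx_zero, Negative.bx_one]; omega,
    by simp only [Negative.Rect.box, Set.mem_setOf_eq, Negative.bx_zero, Negative.bx_one]; omega⟩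

/-- SURJECTIVITY OF THE CROSSING PATTERN: for every row pattern `r` there is a self-avoiding walk
`(i, ·) ⇝ (L, 0)` of the ladder graph in the columns `≥ i` whose crossing count at the face `(j, 0)`
is `[r j]` for `i ≤ j < L` — by downward induction on the column: from `(i, ρ)` step East if
`[r i] = ρ`, else take the rung to `(i, 1 - ρ)` first. [folklore] -/
private theorem ladder_exists (r : ℕ → Bool) : ∀ (n i : ℕ) (u : Site 2), i + n = L → u 0 = i →
    (u 1 = 0 ∨ u 1 = 1) → ∃ p : G.Walk u (bx L 0), p.IsPath ∧ (∀ x ∈ p.support, (i : ℤ) ≤ x 0) ∧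
      ∀ j : ℕ, i ≤ j → j < L → wcross j 0 p = if r j then 1 else 0 := by
  intro n
  induction n with
  | zero =>
    intro i u hi hu0 hu1
    obtain rfl : L = i := by omega
    rcases hu1 with hu1 | hu1
    · obtain rfl : u = bx L 0 := site_ext (by simpa using hu0) (by simpa using hu1)
      exact ⟨SimpleGraph.Walk.nil, SimpleGraph.Walk.IsPath.nil, by simp, fun j hj hjL => by omega⟩
    · obtain rfl : u = bx L 1 := site_ext (by simpa using hu0) (by simpa using hu1)
      have h : G.Adj (bx L 1) (bx L 0) :=
        adj_of_ladder hG (Negative.adj_bx _ _ _ _ (Or.inr (Or.inr (Or.inr ⟨by norm_num, rfl⟩))))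
          (by omega) (by omega)
      refine ⟨SimpleGraph.Walk.cons h SimpleGraph.Walk.nil, ?_, ?_, fun j hj hjL => by omega⟩
      · rw [SimpleGraph.Walk.cons_isPath_iff]
        refine ⟨SimpleGraph.Walk.IsPath.nil, fun hm => ?_⟩
        rw [SimpleGraph.Walk.support_nil, List.mem_singleton] at hm
        simpa using congrArg (fun z : Site 2 => z 1) hm
      · intro x hx
        rw [SimpleGraph.Walk.support_cons, SimpleGraph.Walk.support_nil, List.mem_cons,
          List.mem_singleton] at hx
        rcases hx with rfl | rfl <;> simp
  | succ n ih =>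
    intro i u hi hu0 hu1
    -- the prescribed row `t` of the step across the gap `i`
    obtain ⟨t, ht, htr⟩ : ∃ t : ℤ, (t = 0 ∨ t = 1) ∧ ((if r i then 1 else 0 : ℤ) = t) := ⟨_, by
      split_ifs <;> simp, rfl⟩
    obtain ⟨p', hp', hs', hw'⟩ := ih (i + 1) (bx (i + 1) t) (by omega) (by simp) (by simpa using ht)
    have hE : G.Adj (bx i t) (bx (i + 1) t) :=
      adj_of_ladder hG (Negative.adj_bx _ _ _ _ (Or.inl ⟨rfl, rfl⟩)) (by omega) (by omega)
    have hw0 : wcross (i : ℤ) 0 p' = 0 := wcross_eq_zero_of_col _ _ p'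
      (Or.inl fun x hx => by have := hs' x hx; push_cast at this; omega)
    have hns : ∀ y : Site 2, y 0 = i → y ∉ p'.support := fun y hy hmem => by
      have := hs' y hmem; push_cast at this; omega
    rcases eq_or_ne (u 1) t with hut | hut
    · -- same row: step East
      obtain rfl : u = bx i t := site_ext (by simpa using hu0) (by simpa using hut)
      refine ⟨SimpleGraph.Walk.cons hE p', ?_, ?_, ?_⟩
      · rw [SimpleGraph.Walk.cons_isPath_iff]
        exact ⟨hp', hns _ rfl⟩
      · intro x hx
        rw [SimpleGraph.Walk.support_cons, List.mem_cons] at hx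
        rcases hx with rfl | hx
        · simp
        · have := hs' x hx; push_cast at this; omega
      · intro j hj hjL
        rw [Ladder.wcross_east hE p' ⟨by simp, rfl⟩ (by simpa using ht)]
        rcases Nat.eq_or_lt_of_le hj with rfl | hlt
        · rw [hw0, add_zero, htr.symm]
          simp only [Negative.bx_zero, Negative.bx_one, true_and]
          split_ifs <;> simp_all
        · rw [if_neg (by simp; omega), zero_add]
          exact hw' j hlt hjL
    · -- other row: rung, then East
      obtain rfl : u = bx i (1 - t) := site_ext (by simpa using hu0) (by simp; omega)
      have hR : G.Adj (bx i (1 - t)) (bx i t) :=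
        adj_of_ladder hG (Negative.adj_bx _ _ _ _ (by omega)) (by omega) (by omega)
      refine ⟨SimpleGraph.Walk.cons hR (SimpleGraph.Walk.cons hE p'), ?_, ?_, ?_⟩
      · rw [SimpleGraph.Walk.cons_isPath_iff, SimpleGraph.Walk.cons_isPath_iff,
          SimpleGraph.Walk.support_cons, List.mem_cons, not_or]
        refine ⟨⟨hp', hns _ rfl⟩, fun he => ?_, hns _ rfl⟩
        have := congrArg (fun z : Site 2 => z 1) he
        simp only [Negative.bx_one] at this
        omega
      · intro x hx
        rw [SimpleGraph.Walk.support_cons, SimpleGraph.Walk.support_cons, List.mem_cons,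
          List.mem_cons] at hx
        rcases hx with rfl | rfl | hx
        · simp
        · simp
        · have := hs' x hx; push_cast at this; omega
      · intro j hj hjL
        rw [Ladder.wcross_rung_east hR hE p' ⟨rfl, by simp⟩ ⟨by simp, by simp⟩ (by simp; omega)]
        rcases Nat.eq_or_lt_of_le hj with rfl | hlt
        · rw [hw0, add_zero, htr.symm]
          simp only [Negative.bx_zero, Negative.bx_one, true_and]
          split_ifs <;> simp_all
        · rw [if_neg (by simp; omega), zero_add]
          exact hw' j hlt hjL

end Ladder

/-- STUB T4a `stub_ladderStructure` of line `corner-localisation` (crux `LeftRightFKG`,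
stmt-CriticalPhenomena-11232): COMBINATORICS OF THE 2-ROW LADDER. If `Ω_1` is the lattice graph
induced on the ladder `{0..L} × {0,1}` (adjacency = lattice adjacency inside the open box
`(-1, L+1) × (-1, 2)`), then for the chords `(0,0) → (L,0)`: (i) every chord stays in the ladder;
(ii) each facewise crossing count `wcross i 0` (`i < L`) is `0` or `1`; (iii)
`|γ| = L + #{i ≤ L : [1 ≤ wcross i 0 γ] ≠ [1 ≤ wcross (i-1) 0 γ]}`; (iv) a chord is determined by
its crossing counts; (v) every `0/1` pattern occurs. Proof: (i) `Ladder.support_ladder`;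
(ii)–(iv) `stub_ladderStructureAux` at column `0` (the phantom count `wcross (-1) 0 γ` vanishes
because no vertex has column `-1`); (v) `ladder_exists`. [folklore] -/
theorem stub_ladderStructure : ∀ (L : ℕ) (Ω : Set ℂ),
    (∀ u v : Site 2, (discreteDomainGraph Ω 1).Adj u v ↔
      (zdGraph 2).Adj u v ∧ u ∈ Negative.Rect.box (-1) (L + 1) (-1) 2 ∧ v ∈ Negative.Rect.box (-1) (L + 1) (-1) 2) →
    (∀ γ : SAW.DomainSAW Ω 1 (bx 0 0) (bx L 0),
      (∀ v ∈ γ.walk.support, (0 ≤ v 0 ∧ v 0 ≤ L) ∧ (0 ≤ v 1 ∧ v 1 ≤ 1)) ∧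
      (∀ i : ℕ, i < L → wcross i 0 γ.walk = 0 ∨ wcross i 0 γ.walk = 1) ∧
      γ.length = L + ((Finset.range (L + 1)).filter (fun i : ℕ =>
        decide (1 ≤ wcross i 0 γ.walk) ≠ decide (1 ≤ wcross ((i : ℤ) - 1) 0 γ.walk))).card) ∧
    (∀ γ₁ γ₂ : SAW.DomainSAW Ω 1 (bx 0 0) (bx L 0),
      (∀ i : ℕ, i < L → wcross i 0 γ₁.walk = wcross i 0 γ₂.walk) → γ₁ = γ₂) ∧
    (∀ v : Fin L → Bool, ∃ γ : SAW.DomainSAW Ω 1 (bx 0 0) (bx L 0),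
      ∀ i : Fin L, decide (1 ≤ wcross (i : ℤ) 0 γ.walk) = v i) := by
  intro L Ω hadj
  have hsupp : ∀ γ : SAW.DomainSAW Ω 1 (bx 0 0) (bx L 0), ∀ v ∈ γ.walk.support,
      (0 ≤ v 0 ∧ v 0 ≤ L) ∧ (0 ≤ v 1 ∧ v 1 ≤ 1) := fun γ =>
    Ladder.support_ladder hadj γ.walk (by simp)
  have hW : ∀ γ : SAW.DomainSAW Ω 1 (bx 0 0) (bx L 0),
      bx (((0 : ℕ) : ℤ) - 1) ((bx 0 0) 1) ∉ γ.walk.support := fun γ h => by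
    have := hsupp γ _ h
    simp only [Negative.bx_zero] at this
    omega
  have K := fun γ : SAW.DomainSAW Ω 1 (bx 0 0) (bx L 0) =>
    stub_ladderStructureAux L _ hadj L 0 (bx 0 0) γ.walk (zero_add L) rfl (Or.inl rfl) γ.isPath (hW γ)
  refine ⟨fun γ => ⟨hsupp γ, fun i hi => (K γ).2.1 i (Nat.zero_le i) hi, ?_⟩,
    fun γ₁ γ₂ h => ?_, fun v => ?_⟩
  · -- (iii) the length formula
    have hm1 : wcross (-1) 0 γ.walk = 0 := wcross_eq_zero_of_col _ _ γ.walk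
      (Or.inl fun x hx => by have := hsupp γ x hx; omega)
    have h3 := (K γ).2.2.1
    rw [add_zero] at h3
    show γ.walk.length = _
    rw [h3, Finset.range_eq_Ico]
    congr 1
    congr 1
    refine Finset.filter_congr fun j _ => ?_
    rw [Ne, decide_eq_decide]
    by_cases hj : j = 0
    · subst hj
      simp [hm1]
    · rw [if_neg hj]
  · -- (iv) injectivity
    have hw : γ₁.walk = γ₂.walk :=
      (K γ₁).2.2.2 γ₂.walk γ₂.isPath (hW γ₂) fun j _ hj => h j hj
    cases γ₁; cases γ₂; cases hw; rfl
  · -- (v) surjectivity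
    obtain ⟨p, hp, -, hw⟩ := ladder_exists hadj (fun j => if h : j < L then v ⟨j, h⟩ else false)
      L 0 (bx 0 0) (zero_add L) rfl (Or.inl rfl)
    refine ⟨⟨p, hp⟩, fun i => ?_⟩
    have := hw i (Nat.zero_le _) i.isLt
    simp only [dif_pos i.isLt, Fin.eta] at this
    show decide (1 ≤ wcross ((i : ℕ) : ℤ) 0 p) = v i
    rw [this]
    rcases Bool.eq_false_or_eq_true (v i) with h | h <;> simp [h]

end Summit.CriticalPhenomena.SAWScalingLimit.Theorems.LeftRightFKG.Families
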